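import Literature.MathematicalPhysics.QuantumFieldTheory.Balaban1983to89.B9C2FormBoxRegimeY
import Literature.MathematicalPhysics.QuantumFieldTheory.Balaban1983to89.B9C2LettersRealSymm
import Literature.MathematicalPhysics.QuantumFieldTheory.Balaban1983to89.B9Delta2FormMajorantOf149

/-!
# `Balaban1983to89.B9C2FormMajTorusLettersY` — [B9] (3.136)–(3.137) pp. 422–423 with [B7] (149) p. 40 and (3.35) p. 396: **THE N06 LETTER `hC2` FOR THE TORUS
# READING OF [5]'s `C⁽²⁾`** — for the form letter generated (`B9C2LettersRealSymm.c2LettersOfRawY`) by the raw datum `rawFormY w` (`B9C2LettersTorusY`: the polarised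
# `C_{j(c)}⁽²⁾` of [B7] read on the member torus), EVERY configuration of print's class (3.35) with values in `G ≤ U(N)` satisfies the certificate's three-point block letter
# `C2FormMaj` at the block map `bI`, with `κ_C·w_C(c) ≥ ‖w c‖·C₃·(L^{j(c)})^{1−d}·e^{2δ_C(ℓ+4)}` — modulo [B7]'s printed smallness window on `M·α₀`

T. Bałaban, *Propagators for lattice gauge theories in a background field*, Commun. Math. Phys. **99** (1985) 389–434 [`Balaban1985BackgroundPropagators`, "B9"];
[5] = [B7] = T. Bałaban, *Averaging operations for lattice gauge theories*, Commun. Math. Phys. **98** (1985) 17–51 [`Balaban1985Averaging`]; [4] = T. Bałaban,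
*Propagators and renormalization transformations … II*, Commun. Math. Phys. **96** (1984) 223–250 [`Balaban1984PropagatorsII`].
statement-level skeleton of published theorems with citation tags; proofs where landed; nothing here is a claim about the Yang–Mills mass gap.

THE PRINT.  [B9] p. 422–423: *«The inequality (149) in [5] implies … hence |(Δ⁽²⁾A)(b)| ≦ O(1)Mα₀(Lʲη)⁻²|A| … and the supremum |A| is taken over several j-blocks
surrounding Δ(y)»* — the input of that step is (149) for `C⁽²⁾` at a (3.35)-regular `U`; [B7] p. 40 (149), p. 24 (locality), p. 26 ((52) and its locality sentence); [B9]
(3.35) p. 396.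

WHY THIS FILE (seat dag-n06-l g34, programme P-C2, the ASSEMBLY; memo `HOME/pub-ymgap-dag-n06-l/C2-INSTANCE-MEMO.md`).  The N06 certificate («VO») displays
`hC2 : … Reg335 c α₀ U → Reg336 c α₀ U → C2FormMaj x.toKIdx (bI x) id (𝔠 x).form U κC δC2 (len·n⁻¹)` for its free datum `𝔠`.  For the datum GENERATED by the torus reading
(def-Y's record pin, one line over `c2LettersOfRawY ∘ rawFormY w`) this file proves that letter from print's class (3.35) alone: the socket (`B9Delta2FormMajorantOf149`),
the (149) entries at the carriers (`B9C2LettersTorusY` §3), the real-symmetric letter's entries (`B9C2LettersRealSymm.norm_form_apply_le_of_symm`), the regime at the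
retracted reading (`B9C2FormBoxRegimeY.pdev_retract_readY_le_of_reg335P`) and the geometry line (`dist_bI_le_of_boxCount_ne_zero`) — composed.

WHAT THIS FILE PROVES (0 sorry; theorems only).
* §1 `star_deltaY`, `norm_star_pi` (bookkeeping: `(δ_z⊗a)⋆ = δ_z⊗a⋆`, `‖A⋆‖_∞ = ‖A‖_∞`), `rawFormY_symm_of` (symmetry of the raw datum at a regular `U`, from `rawPolY_symm_of`).
* §2 ★★★ `c2FormMaj_of_torusLetters` — AT A k-LEVEL INDEX `i`, `G ≤ U(N)`, `U` in print's class (3.35) (`bg9KP`, constant `c₀ ≤ 10`), [B7]'s smallness window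
  (`K_pl(Mα₀)·L⁴ < α₀′`, `C₀α₀′ ≤ ⅓`, `4α₀′ ≤ c₂′`, (145)∕(155)∕Prop.-4 smallness at a radius `b₀`), weights `w` and a budget
  `‖w c‖·C₃·(L^{j(c)})²·(L^{j(c)})^{−(d+1)}·e^{2δ_C(ℓ+4)} ≤ κ_C·w_C(c)`:  `C2FormMaj i bI id ((c2LettersOfRawY i (rawFormY i w)).form U) U κ_C δ_C w_C`.
NOT CLAIMED: the choice of `w` ∕ `κ_C` matching the certificate's `w_C = len·n⁻¹` (def-Y's pin decides `w`; with `w c = (Lʲη)·L^{−2j}` it is immediate); the member-level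
restatement over `bg9YR`∕`regYP335` (one `.1` away); the B7 window as displayed numerics of the certificate (n06-d's fold).
-/

noncomputable section

open scoped BigOperators Matrix.Norms.L2Operator

namespace Literature.MathematicalPhysics.QuantumFieldTheory.Balaban1983to89.B9C2FormMajTorusLettersY

open Node00 (CfgY FBondY IBondY deltaY C2LettersY)
open B6KLevelCensusIndexV1 (KIdx kGeo)
open B6GlobalChartV1 (PV blkV1)
open B6Ineq2142KLevelV1 (lvl β)
open B7Prop2Explicit (pdev unitaryUnits C0 c2' avgClosed_unitaryUnits)
open B7Prop3Flat (c3)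
open B7Prop5GeneralLevels (C3Gen thetaGen C1ppGen)
open B12Ineq417Flat (boxBonds)
open B7Eq52RetractionExtension (retrCfg)
open B7Eq136SecondOrderPeriodic (boxCount)
open B9C2LettersTorusY (T0 readY zOf κOf rawPolY rawFormY rawFormY_apply rawPolY_symm_of norm_rawFormY_deltaY_le_of boxCount_lvl_le_one)
open B9C2LettersRealSymm (c2LettersOfRawY norm_form_apply_le_of_symm)
open B9C2FormBoxRegimeY (Kpl Kpl_nonneg pdev_retract_readY_le_of_reg335P retract_readY_agree retract_readY_mem dist_bI_le_of_boxCount_ne_zero)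
open B9Delta2FormMajorant (C2FormMaj)
open B9Delta2FormMajorantOf149 (c2FormMaj_of_ineq149_symm)
open B9BackgroundsKLevelV1P (bg9KP mem_of_reg335P)
open B9GeoNormsKLevelV1 (geo9K)
open B6Geom246MultiLevelTorus (geomT)

variable {d ℓ : ℕ} {hd : 1 ≤ d + 1} {hL : Odd (ℓ + 1) ∧ 1 < ℓ + 1} {b₀ b₁ : ℝ}
variable (i : KIdx d ℓ hd hL b₀ b₁) {N : ℕ} [Nonempty (Fin N)]

/-! ## §1 Bookkeeping -/

omit [Nonempty (Fin N)] in
/-- `(δ_z ⊗ a)⋆ = δ_z ⊗ a⋆`. [cite: Balaban1985BackgroundPropagators, (3.48) p.398, bookkeeping] -/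
theorem star_deltaY (z : FBondY i) (a : Matrix (Fin N) (Fin N) ℂ) : star (deltaY z a) = deltaY z (star a) := by
  classical
  funext w
  simp only [Pi.star_apply, deltaY]
  split_ifs <;> simp

omit [Nonempty (Fin N)] in
/-- `‖A⋆‖_∞ = ‖A‖_∞` for a matrix-valued bond field (operator norm). [cite: Balaban1985Averaging, (19) p.21, bookkeeping] -/
theorem norm_star_pi (A : FBondY i → Matrix (Fin N) (Fin N) ℂ) : ‖star A‖ = ‖A‖ := norm_star A

variable (hℓ : 2 ≤ ℓ + 1) {G : Subgroup (Matrix (Fin N) (Fin N) ℂ)ˣ} (hGU : G ≤ unitaryUnits (Matrix (Fin N) (Fin N) ℂ))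
  {U : CfgY (Matrix (Fin N) (Fin N) ℂ) i} {c₀ α₀ : ℝ} (hc : c₀ ≤ 10) (hMα : 0 ≤ (kGeo i).M * α₀)
  (hreg : (bg9KP (Matrix (Fin N) (Fin N) ℂ) G i).Reg335 c₀ α₀ U)
  {α₀' : ℝ} (hK : Kpl i ((kGeo i).M * α₀) * (kGeo i).L ^ 4 < α₀')
  (hα3 : C0 (d + 1) * α₀' ≤ 1 / 3) (hα4 : 4 * α₀' ≤ c2' (d + 1) (ℓ + 1))
  {bb : ℝ} (hbb : 0 < bb)
  (hsmall : Real.exp (4 * (800 * (((d + 1 : ℕ) : ℝ) + 1) ^ 2 * (((d + 1 : ℕ) : ℝ) + 4)) * α₀') * (1 + 8 * (131072 * (((d + 1 : ℕ) : ℝ) + 1) ^ 2) * bb) ≤ 2)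
  (hc₃ : 4 * bb < c3 (d + 1) (ℓ + 1))
  (h145 : 8 * ((d + 1 : ℕ) : ℝ) * thetaGen (d + 1) (ℓ + 1) α₀' * ((ℓ : ℝ) + 1)⁻¹ ^ 4 ≤ 1)
  (h155 : (2 * ((ℓ : ℝ) + 1) - 1) * ((ℓ : ℝ) + 1)⁻¹ ^ 2 + 2 * ((d + 1 : ℕ) : ℝ) * thetaGen (d + 1) (ℓ + 1) α₀' * ((ℓ : ℝ) + 1)⁻¹ ^ 3
    + 1 / 8 * (1 + 2 * ((d + 1 : ℕ) : ℝ) * thetaGen (d + 1) (ℓ + 1) α₀' * ((ℓ : ℝ) + 1)⁻¹ ^ 2 + 2 * ((d + 1 : ℕ) : ℝ) * C3Gen (d + 1) (ℓ + 1) * bb) * ((ℓ : ℝ) + 1)⁻¹ ^ 2 ≤ 1)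

/-- unit-boundedness of a subgroup of the unitary group. [cite: Balaban1985Averaging, (19) p.21, bookkeeping] -/
theorem norm_le_one_of_le_unitary (hGU' : G ≤ unitaryUnits (Matrix (Fin N) (Fin N) ℂ)) (u : (Matrix (Fin N) (Fin N) ℂ)ˣ) (hu : u ∈ G) :
    ‖(u : Matrix (Fin N) (Fin N) ℂ)‖ ≤ 1 :=
  letI : CStarAlgebra (Matrix (Fin N) (Fin N) ℂ) := {}
  (CStarRing.norm_of_mem_unitary ((B7Prop2Explicit.mem_unitaryUnits).1 (hGU' hu))).le

include hGU hc hMα hreg hK in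
/-- the regime data of `B9C2LettersTorusY` §3 at the index bond `c`, AT THE RETRACTED READING (radius `b = b₀ ∕ L^{j(c)}`, so that `L^{j(c)}·b = b₀`).
[cite: Balaban1985Averaging, (52) p.26, Proposition 4 p.38 (the smallness window)] [cite: Balaban1985BackgroundPropagators, (3.35) p.396] -/
theorem regime_at (c : IBondY i) :
    letI : CStarAlgebra (Matrix (Fin N) (Fin N) ℂ) := {}
    (∀ x κ, retrCfg (B7Prop1Local.loK (ℓ + 1) (lvl i.hN i.D i.hk c) (zOf i c)) (B7Prop1Local.bondHiK (ℓ + 1) (lvl i.hN i.D i.hk c) (zOf i c) (κOf i c))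
        (readY i U) x κ ∈ unitaryUnits (Matrix (Fin N) (Fin N) ℂ)) ∧
      pdev (retrCfg (B7Prop1Local.loK (ℓ + 1) (lvl i.hN i.D i.hk c) (zOf i c)) (B7Prop1Local.bondHiK (ℓ + 1) (lvl i.hN i.D i.hk c) (zOf i c) (κOf i c))
        (readY i U)) < α₀' * ((((ℓ : ℝ) + 1) ^ lvl i.hN i.D i.hk c)⁻¹) ^ 2 := by
  refine ⟨fun x κ => hGU (retract_readY_mem i (mem_of_reg335P (𝔸 := Matrix (Fin N) (Fin N) ℂ) (G := G) i hreg) c x κ), ?_⟩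
  have hL : (kGeo i).L = (ℓ : ℝ) + 1 := by rw [show (kGeo i).L = ((ℓ + 1 : ℕ) : ℝ) from rfl]; push_cast; ring
  have hpos : 0 < ((((ℓ : ℝ) + 1) ^ lvl i.hN i.D i.hk c)⁻¹) ^ 2 := by positivity
  have h := pdev_retract_readY_le_of_reg335P i (norm_le_one_of_le_unitary hGU) U hc hMα hreg c
  rw [hL] at h
  calc _ ≤ Kpl i ((kGeo i).M * α₀) * (((ℓ : ℝ) + 1) ^ 4 * ((((ℓ : ℝ) + 1) ^ lvl i.hN i.D i.hk c)⁻¹) ^ 2) := h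
    _ = (Kpl i ((kGeo i).M * α₀) * (kGeo i).L ^ 4) * ((((ℓ : ℝ) + 1) ^ lvl i.hN i.D i.hk c)⁻¹) ^ 2 := by rw [hL]; ring
    _ < α₀' * ((((ℓ : ℝ) + 1) ^ lvl i.hN i.D i.hk c)⁻¹) ^ 2 := mul_lt_mul_of_pos_right hK hpos

include hℓ hGU hc hMα hreg hK hα3 hα4 hbb hsmall hc₃ in
/-- the raw datum is symmetric at a regular `U`. [cite: Balaban1985Variational, (56) p.286] [cite: Balaban1985BackgroundPropagators, (3.35) p.396] -/
theorem rawFormY_symm_of (w : IBondY i → ℂ) (A A' : FBondY i → Matrix (Fin N) (Fin N) ℂ) : rawFormY i w U A A' = rawFormY i w U A' A := by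
  letI : CStarAlgebra (Matrix (Fin N) (Fin N) ℂ) := {}
  funext c
  obtain ⟨hUhat, h52⟩ := regime_at i hGU hc hMα hreg hK c
  have hα : 0 < α₀' := lt_of_le_of_lt (by have := Kpl_nonneg i hMα; have : (0:ℝ) ≤ (kGeo i).L ^ 4 := by
    { rw [show (kGeo i).L = ((ℓ + 1 : ℕ) : ℝ) from rfl]; positivity }; positivity) hK
  have hLj : (0 : ℝ) < ((ℓ : ℝ) + 1) ^ lvl i.hN i.D i.hk c := by positivity
  set b : ℝ := bb * ((((ℓ : ℝ) + 1) ^ lvl i.hN i.D i.hk c))⁻¹ with hbdef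
  have hb : 0 < b := by positivity
  have hLb : ((ℓ : ℝ) + 1) ^ lvl i.hN i.D i.hk c * b = bb := by rw [hbdef]; field_simp
  rw [rawFormY_apply, rawFormY_apply,
    rawPolY_symm_of i hℓ (avgClosed_unitaryUnits (d + 1) (ℓ + 1)) c hUhat (retract_readY_agree i U c) hα hα3 hα4 h52 hb
      (by rw [hLb]; exact hsmall) (by rw [hLb]; exact hc₃) A A']

/-! ## §2 The letter -/

include hℓ hGU hc hMα hreg hK hα3 hα4 hbb hsmall hc₃ h145 h155 in
/-- ★★★ **THE N06 LETTER `hC2` FOR THE GENERATED TORUS FORM, FROM PRINT'S CLASS (3.35) AND [B7] (149)**: at a k-level index `i` with a 1-faithful block map `bI`, for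
`U` in print's class (`bg9KP`, `c₀ ≤ 10`) with values in `G ≤ U(N)`, inside [B7]'s smallness window, and weights∕budget
`‖w c‖·C₃·(L^{j(c)})²·(L^{j(c)})^{−(d+1)}·e^{2δ_C(ℓ+4)} ≤ κ_C·w_C(c)`:
`C2FormMaj i bI id ((c2LettersOfRawY i (rawFormY i w)).form U) U κ_C δ_C w_C`. [cite: Balaban1985BackgroundPropagators, (3.136)–(3.137) pp.422–423, (3.35) p.396]
[cite: Balaban1985Averaging, (149) p.40, (141) p.39, p.24, (52) p.26] [cite: Balaban1984PropagatorsII, (2.46) p.231, (2.51) p.232] -/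
theorem c2FormMaj_of_torusLetters {bI : FBondY i → IBondY i}
    (hβ1 : ∀ f : FBondY i, (geomT i.D).dist (β i.hN i.D i.hk (bI f)) (blkV1 i.hN i.D f) ≤ 1)
    (w : IBondY i → ℂ) {κC δC : ℝ} (hδC : 0 ≤ δC) {wC : IBondY i → ℝ}
    (hbudget : ∀ c : IBondY i, ‖w c‖ * (C3Gen (d + 1) (ℓ + 1) * (((ℓ : ℝ) + 1) ^ lvl i.hN i.D i.hk c) ^ 2) *
      ((((ℓ : ℝ) + 1) ^ lvl i.hN i.D i.hk c) ^ (d + 1))⁻¹ * Real.exp (2 * δC * ((ℓ : ℝ) + 4)) ≤ κC * wC c) :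
    C2FormMaj i (g := geo9K i) bI (fun c => c) (c2LettersOfRawY i (rawFormY i w)).form U κC δC wC := by
  letI : CStarAlgebra (Matrix (Fin N) (Fin N) ℂ) := {}
  have hα : 0 < α₀' := lt_of_le_of_lt (by have := Kpl_nonneg i hMα; have : (0:ℝ) ≤ (kGeo i).L ^ 4 := by
    { rw [show (kGeo i).L = ((ℓ + 1 : ℕ) : ℝ) from rfl]; positivity }; positivity) hK
  have hC3 : 0 ≤ C3Gen (d + 1) (ℓ + 1) := by unfold C3Gen C1ppGen; positivity
  -- the (149) data at the carriers
  refine c2FormMaj_of_ineq149_symm i (g := geo9K i) bI (fun c => c) _ U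
    (K := fun c => ‖w c‖ * (C3Gen (d + 1) (ℓ + 1) * (((ℓ : ℝ) + 1) ^ lvl i.hN i.D i.hk c) ^ 2))
    (q := fun c z => ((((ℓ : ℝ) + 1) ^ lvl i.hN i.D i.hk c) ^ (d + 1))⁻¹ *
      (boxCount (T0 i) (boxBonds (ℓ + 1) (lvl i.hN i.D i.hk c) (zOf i c) (κOf i c)) (z.src, z.dir) : ℝ))
    (q₀ := fun c => ((((ℓ : ℝ) + 1) ^ lvl i.hN i.D i.hk c) ^ (d + 1))⁻¹) (r := (ℓ : ℝ) + 4)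
    ((c2LettersOfRawY i (rawFormY i w)).symm U) ?_ (fun c => by positivity) (fun c z => by positivity) ?_ ?_ hδC ?_
  · -- (149) entries of the real-symmetric letter from those of the raw datum (at `(A, δ_z⊗a)` and at `(A⋆, δ_z⊗a⋆)`)
    intro A z a c
    obtain ⟨hUhat, h52⟩ := regime_at i hGU hc hMα hreg hK c
    have hLj : (0 : ℝ) < ((ℓ : ℝ) + 1) ^ lvl i.hN i.D i.hk c := by positivity
    set b : ℝ := bb * ((((ℓ : ℝ) + 1) ^ lvl i.hN i.D i.hk c))⁻¹ with hbdef
    have hb : 0 < b := by positivity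
    have hLb : ((ℓ : ℝ) + 1) ^ lvl i.hN i.D i.hk c * b = bb := by rw [hbdef]; field_simp
    have raw : ∀ (A' : FBondY i → Matrix (Fin N) (Fin N) ℂ) (a' : Matrix (Fin N) (Fin N) ℂ),
        ‖rawFormY i w U A' (deltaY z a') c‖ ≤ ‖w c‖ * (C3Gen (d + 1) (ℓ + 1) * (((ℓ : ℝ) + 1) ^ lvl i.hN i.D i.hk c) ^ 2) * ‖A'‖ *
          (((((ℓ : ℝ) + 1) ^ lvl i.hN i.D i.hk c) ^ (d + 1))⁻¹ *
            (boxCount (T0 i) (boxBonds (ℓ + 1) (lvl i.hN i.D i.hk c) (zOf i c) (κOf i c)) (z.src, z.dir) : ℝ)) * ‖a'‖ := by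
      intro A' a'
      have h := norm_rawFormY_deltaY_le_of i hℓ (avgClosed_unitaryUnits (d + 1) (ℓ + 1)) c hUhat (retract_readY_agree i U c) hα hα3 hα4 h52 hb
        (by rw [hLb]; exact hsmall) (by rw [hLb]; exact hc₃) h145 (by rw [hLb]; exact h155) w A' z a'
      refine h.trans (le_of_eq ?_); ring
    refine norm_form_apply_le_of_symm i (rawFormY i w) (rawFormY_symm_of i hℓ hGU hc hMα hreg hK hα3 hα4 hbb hsmall hc₃ w) (raw A a) ?_
    rw [star_deltaY]
    have h := raw (star A) (star a)
    rwa [norm_star_pi, norm_star] at h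
  · -- locality: no box bond over a far `z`
    intro c z hfar
    have h0 : boxCount (T0 i) (boxBonds (ℓ + 1) (lvl i.hN i.D i.hk c) (zOf i c) (κOf i c)) (z.src, z.dir) = 0 := by
      by_contra hne
      exact absurd (dist_bI_le_of_boxCount_ne_zero i hβ1 c hne) (not_le.2 hfar)
    simp [h0]
  · -- `N_c(z) ≤ 1`
    intro c z
    have h1 : (boxCount (T0 i) (boxBonds (ℓ + 1) (lvl i.hN i.D i.hk c) (zOf i c) (κOf i c)) (z.src, z.dir) : ℝ) ≤ 1 := by
      exact_mod_cast boxCount_lvl_le_one i c z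
    have h0 : 0 ≤ ((((ℓ : ℝ) + 1) ^ lvl i.hN i.D i.hk c) ^ (d + 1))⁻¹ := by positivity
    calc _ ≤ ((((ℓ : ℝ) + 1) ^ lvl i.hN i.D i.hk c) ^ (d + 1))⁻¹ * 1 := mul_le_mul_of_nonneg_left h1 h0
      _ = _ := mul_one _
  · -- the budget
    intro c
    have h := hbudget c
    calc ‖w c‖ * (C3Gen (d + 1) (ℓ + 1) * (((ℓ : ℝ) + 1) ^ lvl i.hN i.D i.hk c) ^ 2) * ((((ℓ : ℝ) + 1) ^ lvl i.hN i.D i.hk c) ^ (d + 1))⁻¹ *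
          Real.exp (2 * δC * ((ℓ : ℝ) + 4)) ≤ κC * wC c := h
      _ = κC * wC ((fun c => c) c) := rfl

end Literature.MathematicalPhysics.QuantumFieldTheory.Balaban1983to89.B9C2FormMajTorusLettersY
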